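import Mathlib
import HarnessLib
import Summits.QuantumFields.YangMills.Theorems.HypercubicLimit.Negative.NonabelianLoadBearing
import Literature.MathematicalPhysics.QuantumFieldTheory.YangMillsOS
import Literature.MathematicalPhysics.QuantumLattice.LatticeGaugeDLR

/-!
# drefute probe — load-bearing analysis of the window stubs of line `conditional-mean-telescoping`
(crux `HypercubicLimit`, stmt-QuantumFields-8646) at the junk group `G = PUnit`.

Objects and stub statements are VERBATIM copies of
`Cruxes/HypercubicLimit/Lines/conditional-mean-telescoping.lean` §0, §2–§4 (namespace changed only),
so every theorem below transplants textually.
-/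

noncomputable section

open scoped SchwartzMap ENNReal
open MeasureTheory Filter Topology
open Literature.MathematicalPhysics.AQFT Literature.MathematicalPhysics.QuantumLattice
open Literature.MathematicalPhysics.QuantumFieldTheory

namespace Summit.QuantumFields.YangMills.Cruxes.HypercubicLimit.DRefute

local notation "E4" => EuclideanSpace ℝ (Fin 4)
local notation "Zd4" => Literature.Probability.LatticeModels.Site 4
local notation "ZdEdge4" => Literature.MathematicalPhysics.QuantumLattice.ZdEdge 4

/-! ## 0. Objects: one plaquette, its cube-exterior influence, its RP square -/

section Objects

variable {G : Type} [Group G] [TopologicalSpace G] [IsTopologicalGroup G] [CompactSpace G]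
  [MeasurableSpace G] [BorelSpace G]

/-- Edges of `ℤ⁴` interior to the `ℓ^∞`-cube of radius `R` about `x` (both endpoints inside). -/
def cubeEdges (R : ℕ) (x : Zd4) : Set ZdEdge4 :=
  {e | (∀ μ, |e.1 μ - x μ| ≤ R) ∧ ∀ μ, |e.1 μ + (if μ = e.2 then 1 else 0) - x μ| ≤ R}

/-- Their images on the torus of side `L` (the cube must fit: `2R + 2 ≤ L`). -/
def cubeEdgesT (L R : ℕ) (x : Zd4) : Set (Edge 4 L) :=
  torusEdge L '' cubeEdges R x

/-- The **exterior σ-algebra** of the cube `Q_R(x)`: cylinder events of the torus links NOT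
interior to the cube (Mathlib `cylinderEvents`). -/
@[reducible] def exterior (L R : ℕ) (x : Zd4) : MeasurableSpace (GaugeConfig 4 L G) :=
  cylinderEvents (X := fun _ : Edge 4 L => G) (cubeEdgesT L R x)ᶜ

/-- The single plaquette observable `Re tr ρ(U_p)` of orientation `(i, j)` based at the
`ℤ⁴`-site `x`, on the torus of side `L` (periodic lift). -/
def torusPlaquette (r : LatticeRep G) (L : ℕ) (i j : Fin 4) (x : Zd4) (U : GaugeConfig 4 L G) : ℝ :=
  plaquetteObs r.ρ x i j (torusLift L U)

/-- The curvature species (Wilson action density, six plaquettes) at the `ℤ⁴`-site `x` on the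
torus of side `L`, with EXACTLY the translation convention of `smearedLatticeField`. -/
def torusDensity (r : LatticeRep G) (L : ℕ) (x : Zd4) (U : GaugeConfig 4 L G) : ℝ :=
  r.curvature.F (configShift (-x) (torusLift L U))

/-- **Influence profile** (real-valued) `I_p^{(ij)}(β, S, R) :=
‖ E_{β,S}[ p_{ij}(0) − ⟨p_{ij}(0)⟩ | exterior of Q_R(0) ] ‖_{Lᵖ(μ_{β,S})}` on the symmetric torus
of side `2S+1` — ONE plaquette, ONE cube. -/
def influence (r : LatticeRep G) (β : ℝ) (S R : ℕ) (i j : Fin 4) (p : ℝ≥0∞) : ℝ :=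
  let μ := wilsonMeasure (d := 4) (L := 2 * S + 1) r.ρ β
  let X : GaugeConfig 4 (2 * S + 1) G → ℝ :=
    fun U => torusPlaquette r (2 * S + 1) i j 0 U - ∫ V, torusPlaquette r (2 * S + 1) i j 0 V ∂μ
  (eLpNorm (μ[X | exterior (2 * S + 1) R 0]) p μ).toReal

/-- **Reference RP square** `A(β, S, R) := ⟨θX · X⟩_{β,S}`, `X = p₀₁(R e₀) − ⟨p₀₁⟩`,
`θ = GaugeConfig.timeReflect` (`t ↦ 1 − t`): the reflection-positivity square of ONE plaquette at
height `R` above the reflection hyperplane (reflected separation `2R − 1`); `= ‖E[X | lower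
half]‖₂²` in infinite volume (the half-space anchor of the card). -/
def rpSquare (r : LatticeRep G) (β : ℝ) (S R : ℕ) : ℝ :=
  let μ := wilsonMeasure (d := 4) (L := 2 * S + 1) r.ρ β
  let X : GaugeConfig 4 (2 * S + 1) G → ℝ :=
    fun U => torusPlaquette r (2 * S + 1) 0 1 (Pi.single 0 (R : ℤ)) U -
      ∫ V, torusPlaquette r (2 * S + 1) 0 1 (Pi.single 0 (R : ℤ)) V ∂μ
  ∫ U, X (GaugeConfig.timeReflect U) * X U ∂μ

/-- Reflected-pair two-point function of the ACTION DENSITY: `Cov(P_x ∘ θ, P_y)` on the torus of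
side `2S+1` (the summand of the lattice RP square of a smeared curvature field; `P ∘ θ` is the
action density with its temporal plaquettes hanging downward from `θx`). -/
def reflPair (r : LatticeRep G) (β : ℝ) (S : ℕ) (x y : Zd4) : ℝ :=
  let μ := wilsonMeasure (d := 4) (L := 2 * S + 1) r.ρ β
  (∫ U, torusDensity r (2 * S + 1) x (GaugeConfig.timeReflect U) * torusDensity r (2 * S + 1) y U ∂μ) -
    (∫ U, torusDensity r (2 * S + 1) x (GaugeConfig.timeReflect U) ∂μ) *
      ∫ U, torusDensity r (2 * S + 1) y U ∂μ

/-- Smeared connected three-point function of the centred action density at lattice spacing `a`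
(Riemann normalisation `a¹² = (a⁴)³`, no multiplicative renormalisation): the `κ₃` the closure
renormalises by `c_k³`. -/
def smearedThreePoint (r : LatticeRep G) (β : ℝ) (S : ℕ) (a : ℝ) (φ₁ φ₂ φ₃ : 𝓢(E4, ℝ)) : ℝ :=
  let μ := wilsonMeasure (d := 4) (L := 2 * S + 1) r.ρ β
  let δP : Zd4 → GaugeConfig 4 (2 * S + 1) G → ℝ :=
    fun x U => torusDensity r (2 * S + 1) x U - ∫ V, torusDensity r (2 * S + 1) x V ∂μ
  a ^ 12 * ∑ x ∈ Literature.Probability.LatticeModels.box 4 S,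
    ∑ y ∈ Literature.Probability.LatticeModels.box 4 S,
      ∑ z ∈ Literature.Probability.LatticeModels.box 4 S,
        φ₁ (a • siteToE x) * φ₂ (a • siteToE y) * φ₃ (a • siteToE z) *
          ∫ U, δP x U * δP y U * δP z U ∂μ

end Objects

/-! ## 2. (L′) The imported IR input: one-scale lattice gap with `ξ → ∞` -/

/-- **Gap data** for `(G, r)`: a rate function `m` on `[β₁, ∞)` with
(i) `0 < m(β)`, `m(β) → 0` (`ξ → ∞`);
(ii) 8901-shape ALL-PAIRS volume-uniform decay of connected time-correlations at rate `m(β)`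
(per-pair constants; feeds `HasLatticeMassGap` verbatim with `a_k := m(β_k)`, `Δ = 1`);
(iii) RP-SPECTRAL relative clustering of centred slab functionals with thermal error `ε(S) → 0`
(what a transfer-matrix gap `spec T ⊆ {1} ∪ [0, e^{-m}]` gives on large tori; scale-free, so it
survives multiplicative renormalisation — feeds `HasMassGap`/E4 of the continuum limit);
(iv) axial comparability: beyond `c₂/m(β)` (and below a quarter of the torus, where thermal
images are negligible) the reference RP square decays per unit height by at most `e^{-C₁ m(β)}`
(pins admissible `m` to the plaquette's own mass, `m_P ≤ C₁ m`). -/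
def GapData (G : Type) [Group G] [TopologicalSpace G] [IsTopologicalGroup G] [CompactSpace G]
    [MeasurableSpace G] [BorelSpace G] (r : LatticeRep G) (β₁ C₁ c₂ : ℝ) (m : ℝ → ℝ) : Prop :=
  (∀ β : ℝ, β₁ ≤ β → 0 < m β) ∧ Tendsto m atTop (𝓝 0) ∧
  (∀ A B : YMSpecies G, ∃ (C : ℝ) (S₀ : ℕ), ∀ β : ℝ, β₁ ≤ β → ∀ S : ℕ, S₀ ≤ S → ∀ n : ℕ, n ≤ S →
      |latticeConnectedCorr r.ρ β (2 * S + 1) A.F B.F n| ≤ C * Real.exp (-(m β * n))) ∧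
  (∀ β : ℝ, β₁ ≤ β → ∃ ε : ℕ → ℝ, Tendsto ε atTop (𝓝 0) ∧
      ∀ (S T n : ℕ), 2 * (T + n + 1) ≤ S →
        ∀ (Y : LGConfig 4 G → ℝ) (B : ℝ), Measurable Y → (∀ U, |Y U| ≤ B) →
          DependsOn Y {e : ZdEdge4 | 1 ≤ e.1 0 ∧ e.1 0 + (if e.2 = 0 then 1 else 0) ≤ T} →
            let μ := wilsonMeasure (d := 4) (L := 2 * S + 1) r.ρ β
            |(∫ U, Y (torusLift (2 * S + 1) (GaugeConfig.timeReflect U)) *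
                  Y (configShift (-Pi.single 0 (n : ℤ)) (torusLift (2 * S + 1) U)) ∂μ) -
                (∫ U, Y (torusLift (2 * S + 1) U) ∂μ) ^ 2|
              ≤ Real.exp (-(m β * n)) *
                  ((∫ U, Y (torusLift (2 * S + 1) (GaugeConfig.timeReflect U)) *
                      Y (torusLift (2 * S + 1) U) ∂μ) -
                    (∫ U, Y (torusLift (2 * S + 1) U) ∂μ) ^ 2) +
                ε S * B ^ 2) ∧
  (∀ β : ℝ, β₁ ≤ β → ∃ S₀ : ℕ, ∀ S : ℕ, S₀ ≤ S → ∀ n : ℕ, c₂ / m β ≤ n → 4 * n + 8 ≤ S →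
      Real.exp (-(C₁ * m β)) * rpSquare r β S n ≤ rpSquare r β S (n + 1))

/-- **(L′) Lattice gap input** (imported IR open problem, shared with
`ModularSelfDualFold.WeakCouplingLatticeGap` 8901 / `XiCompleteMonotonicity.XiDiverges` 8941):
every compact simple `G` has a faithful `r` and gap data. -/
def LatticeGapInput : Prop :=
  ∀ (G : Type) [Group G] [TopologicalSpace G] [IsTopologicalGroup G] [CompactSpace G]
    [MeasurableSpace G] [BorelSpace G], IsCompactSimpleLieGroup G →
    ∃ (r : LatticeRep G) (β₁ C₁ c₂ : ℝ) (m : ℝ → ℝ), GapData G r β₁ C₁ c₂ m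

/-! ## 3. The window cruxes (ONE plaquette, below every fixed fraction of the correlation length) -/

/-- **(WI₂) Corner-free influence** (the `n = 2` content, kit-checkable two-level estimator):
below `c₀/m(β)` the `L²` influence of the EXTERIOR OF A CUBE of radius `R` on a plaquette at its
centre is at most `C(c₀)` times the square root of the reference RP square at height `R` (the
exact `L²` influence of ONE half-space at that distance): the 8 faces cost a constant. -/
def CornerFreeInfluence : Prop :=
  ∀ (G : Type) [Group G] [TopologicalSpace G] [IsTopologicalGroup G] [CompactSpace G]
    [MeasurableSpace G] [BorelSpace G], IsCompactSimpleLieGroup G →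
    ∀ (r : LatticeRep G) (β₁ C₁ c₂ : ℝ) (m : ℝ → ℝ), GapData G r β₁ C₁ c₂ m →
      ∀ c₀ : ℝ, 0 < c₀ → ∃ (C β₀ : ℝ), ∀ β : ℝ, β₀ ≤ β → ∃ S₀ : ℕ, ∀ S : ℕ, S₀ ≤ S →
        ∀ R : ℕ, 1 ≤ R → (R : ℝ) ≤ c₀ / m β → ∀ i j : Fin 4, i ≠ j →
          influence r β S R i j 2 ≤ C * Real.sqrt (rpSquare r β S R)

/-- **(WIₙ) Influence reverse Hölder / hypercontractivity** (rank 2 of the line, the bet): below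
`c₀/m(β)` the `Lⁿ` influence is at most `C(c₀) n^γ` times the `L²` influence, for EVERY `n ≥ 2`,
uniformly in `β` and in the volume (`γ` explicit and polynomial; an `L^∞` version is FALSE —
large-field shells, triage r1-2).  Spectrally a bound on excited-state form factors of the plaquette
by vacuum overlaps; Gaussian value `γ = 1` (order-2 chaos). -/
def InfluenceReverseHolder : Prop :=
  ∀ (G : Type) [Group G] [TopologicalSpace G] [IsTopologicalGroup G] [CompactSpace G]
    [MeasurableSpace G] [BorelSpace G], IsCompactSimpleLieGroup G →
    ∀ (r : LatticeRep G) (β₁ C₁ c₂ : ℝ) (m : ℝ → ℝ), GapData G r β₁ C₁ c₂ m →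
      ∀ c₀ : ℝ, 0 < c₀ → ∃ (C β₀ : ℝ) (γ : ℕ), ∀ β : ℝ, β₀ ≤ β → ∀ n : ℕ, 2 ≤ n →
        ∃ S₀ : ℕ, ∀ S : ℕ, S₀ ≤ S → ∀ R : ℕ, 1 ≤ R → (R : ℝ) ≤ c₀ / m β → ∀ i j : Fin 4, i ≠ j →
          influence r β S R i j n ≤ C * (n : ℝ) ^ γ * influence r β S R i j 2

/-- **(W2) Window regularity of the reference RP square** (rank 3 of the line):
(a) bounded effective exponent — polynomial doubling `A(R) ≤ C (R'/R)^p A(R')` for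
`1 ≤ R ≤ R' ≤ c₀/m(β)` (no exponential regime between the lattice scale and the gap);
(b) reflected-pair cone comparability — for sites `x, y` at heights in `[R, (1+θ)R]` and transverse
offset `≤ θR`, `Cov(P_x ∘ θ, P_y) ≥ c · A(R)` for the ACTION DENSITY `P` (turns the axial anchor into
a smeared reflection-positive normalisation, making `IsNontrivial` automatic);
(c) polynomial floor `A(β, S, 1) ≥ m(β)^q` (the renormalisation constant is polynomial in `1/a_k`). -/
def WindowRegularity : Prop :=
  ∀ (G : Type) [Group G] [TopologicalSpace G] [IsTopologicalGroup G] [CompactSpace G]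
    [MeasurableSpace G] [BorelSpace G], IsCompactSimpleLieGroup G →
    ∀ (r : LatticeRep G) (β₁ C₁ c₂ : ℝ) (m : ℝ → ℝ), GapData G r β₁ C₁ c₂ m →
      ∀ c₀ : ℝ, 0 < c₀ → ∃ (C c θ β₀ : ℝ) (p q : ℕ), 0 < c ∧ 0 < θ ∧
        ∀ β : ℝ, β₀ ≤ β → ∃ S₀ : ℕ, ∀ S : ℕ, S₀ ≤ S →
          (∀ R R' : ℕ, 1 ≤ R → R ≤ R' → (R' : ℝ) ≤ c₀ / m β →
              rpSquare r β S R ≤ C * ((R' : ℝ) / R) ^ p * rpSquare r β S R') ∧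
          (∀ (R : ℕ) (x y : Zd4), 1 ≤ R → (R : ℝ) ≤ c₀ / m β →
              (R : ℝ) ≤ x 0 → (x 0 : ℝ) ≤ (1 + θ) * R → (R : ℝ) ≤ y 0 → (y 0 : ℝ) ≤ (1 + θ) * R →
              (∀ i : Fin 4, i ≠ 0 → (|x i - y i| : ℝ) ≤ θ * R) →
                c * rpSquare r β S R ≤ reflPair r β S x y) ∧
          m β ^ q ≤ rpSquare r β S 1

/-! ## 4. (NG) The non-Gaussianity socket -/

/-- **(NG) Scale-free smeared `κ₃` floor** (socket; suppliers: `running-pole-skewness` via the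
`β`-derivative identity at scale `ξ`, or an NLO window witness): at SOME physical scale `s₁`, for
three fixed Schwartz bumps with pairwise disjoint supports in the ball of radius `s₁`, the smeared
connected three-point function of the action density at lattice spacing `m(β)` has a definite
sign and is at least `c₁ A(⌊s₁/m(β)⌋)^{3/2}` in size, for `β ≥ β₀` on large tori. -/
def NonGaussianFloor : Prop :=
  ∀ (G : Type) [Group G] [TopologicalSpace G] [IsTopologicalGroup G] [CompactSpace G]
    [MeasurableSpace G] [BorelSpace G], IsCompactSimpleLieGroup G →
    ∀ (r : LatticeRep G) (β₁ C₁ c₂ : ℝ) (m : ℝ → ℝ), GapData G r β₁ C₁ c₂ m →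
      ∃ (s₁ σ c₁ β₀ : ℝ) (φ₁ φ₂ φ₃ : 𝓢(E4, ℝ)), 0 < s₁ ∧ (σ = 1 ∨ σ = -1) ∧ 0 < c₁ ∧
        tsupport φ₁ ⊆ Metric.ball 0 s₁ ∧ tsupport φ₂ ⊆ Metric.ball 0 s₁ ∧
        tsupport φ₃ ⊆ Metric.ball 0 s₁ ∧
        Disjoint (tsupport φ₁) (tsupport φ₂) ∧ Disjoint (tsupport φ₁) (tsupport φ₃) ∧
        Disjoint (tsupport φ₂) (tsupport φ₃) ∧
        ∀ β : ℝ, β₀ ≤ β → ∃ S₀ : ℕ, ∀ S : ℕ, S₀ ≤ S →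
          c₁ * Real.sqrt (rpSquare r β S ⌊s₁ / m β⌋₊) ^ 3 ≤
            σ * smearedThreePoint r β S (m β) φ₁ φ₂ φ₃



/-! ## drefute §1. The junk group `G = PUnit`: which stub uses non-triviality of `G`?

`punitRep : LatticeRep PUnit` is the tree's (landed) trivial one-dimensional representation
(`Negative/NonabelianLoadBearing.lean`).  On `GaugeConfig 4 L PUnit` (a one-point space) every
observable is constant, so every centred quantity of the line vanishes identically: `influence`,
`rpSquare`, `reflPair`, `latticeConnectedCorr` are all `0`.  Consequences (all checked below):

* `gapData_punit`: `GapData PUnit r β₁ C₁ c₂ (fun β => exp (-β))` holds for EVERY `β₁ C₁ c₂` — the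
  gap-data interface is inhabited by junk (its four clauses are upper bounds or are homogeneous);
* the bodies of `CornerFreeInfluence`, `InfluenceReverseHolder`, `NonGaussianFloor` and clauses
  (a), (b) of `WindowRegularity` hold at `PUnit` (with `C = 0`, resp. the zero test functions);
* clause (c) of `WindowRegularity` (the polynomial floor `m(β)^q ≤ rpSquare(β,S,1)`) FAILS at
  `PUnit`, hence `WindowRegularity` with the hypothesis `IsCompactSimpleLieGroup G` deleted is
  FALSE (`not_windowRegularityWithoutSimple`).

Reading for the lead: inside this line non-triviality of `G` is consumed by exactly one clause,
W2(c); the three inequalities WI₂ / WIₙ / NG are RELATIVE (both sides carry the same power of the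
plaquette's fluctuation) and are blind to `G = 1`.  In particular the `NonGaussianFloor` socket does
not by itself force `κ₃ ≠ 0`: the closure gets `ThreePointNonGaussian` only from NG × W2(c) × W2(a,b).
-/

section PUnitModel

open Summit.QuantumFields.YangMills.Theorems.HypercubicLimit.Negative (punitRep)

/-- On a one-point probability space every integral is evaluation. -/
theorem integral_eq_apply_default {Ω : Type*} [MeasurableSpace Ω] [Unique Ω] (μ : Measure Ω)
    [IsProbabilityMeasure μ] (f : Ω → ℝ) : ∫ x, f x ∂μ = f default := by
  have hf : f = fun _ => f default := funext fun x => congrArg f (Subsingleton.elim x default)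
  rw [hf, integral_const]
  simp

/-- All `ℤ⁴`-configurations with values in `PUnit` coincide. -/
theorem lgConfig_punit_eq (U V : LGConfig 4 PUnit) : U = V := Subsingleton.elim U V

variable (r : LatticeRep PUnit)

instance isProbabilityMeasure_wilsonMeasure_punit (L : ℕ) [NeZero L] (β : ℝ) :
    IsProbabilityMeasure (wilsonMeasure (d := 4) (L := L) r.ρ β) :=
  isProbabilityMeasure_wilsonMeasure (d := 4) (L := L) r.ρ r.continuous β

/-- The centred torus plaquette vanishes identically for `G = PUnit`. -/
theorem centred_torusPlaquette_punit (L : ℕ) [NeZero L] (β : ℝ) (i j : Fin 4) (x : Zd4) :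
    (fun U : GaugeConfig 4 L PUnit => torusPlaquette r L i j x U -
        ∫ V, torusPlaquette r L i j x V ∂(wilsonMeasure (d := 4) (L := L) r.ρ β)) = 0 := by
  funext U
  rw [integral_eq_apply_default, Pi.zero_apply, Subsingleton.elim U default, sub_self]

/-- The centred torus action density vanishes identically for `G = PUnit`. -/
theorem centred_torusDensity_punit (L : ℕ) [NeZero L] (β : ℝ) (x : Zd4) (U : GaugeConfig 4 L PUnit) :
    torusDensity r L x U - ∫ V, torusDensity r L x V ∂(wilsonMeasure (d := 4) (L := L) r.ρ β) = 0 := by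
  rw [integral_eq_apply_default, Subsingleton.elim U default, sub_self]

/-- `influence ≡ 0` at `G = PUnit` (every exponent, radius, volume, coupling). -/
theorem influence_punit (β : ℝ) (S R : ℕ) (i j : Fin 4) (p : ℝ≥0∞) :
    influence r β S R i j p = 0 := by
  dsimp only [influence]
  rw [centred_torusPlaquette_punit, condExp_zero, eLpNorm_zero, ENNReal.toReal_zero]

/-- Pointwise form of `centred_torusPlaquette_punit`. -/
theorem centred_torusPlaquette_punit_apply (L : ℕ) [NeZero L] (β : ℝ) (i j : Fin 4) (x : Zd4)
    (U : GaugeConfig 4 L PUnit) :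
    torusPlaquette r L i j x U -
        ∫ V, torusPlaquette r L i j x V ∂(wilsonMeasure (d := 4) (L := L) r.ρ β) = 0 := by
  rw [integral_eq_apply_default, Subsingleton.elim U default, sub_self]

/-- `rpSquare ≡ 0` at `G = PUnit`. -/
theorem rpSquare_punit (β : ℝ) (S R : ℕ) : rpSquare r β S R = 0 := by
  dsimp only [rpSquare]
  simp only [centred_torusPlaquette_punit_apply, mul_zero, integral_zero]

/-- `reflPair ≡ 0` at `G = PUnit`. -/
theorem reflPair_punit (β : ℝ) (S : ℕ) (x y : Zd4) : reflPair r β S x y = 0 := by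
  dsimp only [reflPair]
  rw [integral_eq_apply_default, integral_eq_apply_default, integral_eq_apply_default]
  have h1 : torusDensity r (2 * S + 1) x (GaugeConfig.timeReflect (default : GaugeConfig 4 (2 * S + 1) PUnit))
      = torusDensity r (2 * S + 1) x default :=
    congrArg _ (Subsingleton.elim _ _)
  rw [h1]; ring

/-- `latticeConnectedCorr ≡ 0` at `G = PUnit`. -/
theorem latticeConnectedCorr_punit (β : ℝ) (L : ℕ) [NeZero L] (A B : LGConfig 4 PUnit → ℝ) (n : ℕ) :
    latticeConnectedCorr r.ρ β L A B n = 0 := by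
  unfold latticeConnectedCorr
  rw [integral_eq_apply_default, integral_eq_apply_default, integral_eq_apply_default,
    lgConfig_punit_eq (configShift _ (torusLift L default)) (torusLift L default)]
  ring

/-- The smeared three-point function against the zero test functions vanishes (any group). -/
theorem smearedThreePoint_zero {G : Type} [Group G] [TopologicalSpace G] [IsTopologicalGroup G]
    [CompactSpace G] [MeasurableSpace G] [BorelSpace G] (r' : LatticeRep G) (β : ℝ) (S : ℕ) (a : ℝ) :
    smearedThreePoint r' β S a 0 0 0 = 0 := by
  simp [smearedThreePoint]

/-- **Gap data are inhabited by junk**: at `G = PUnit` every clause of `GapData` holds with the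
rate `m(β) = e^{-β}` (positive, `→ 0`), for all `β₁ C₁ c₂`. -/
theorem gapData_punit (β₁ C₁ c₂ : ℝ) : GapData PUnit r β₁ C₁ c₂ (fun β => Real.exp (-β)) := by
  refine ⟨fun β _ => Real.exp_pos _, Real.tendsto_exp_neg_atTop_nhds_zero, ?_, ?_, ?_⟩
  · intro A B
    refine ⟨0, 0, fun β _ S _ n _ => ?_⟩
    rw [latticeConnectedCorr_punit]; simp
  · intro β _
    refine ⟨fun _ => 0, tendsto_const_nhds, fun S T n _ Y B _ _ _ => ?_⟩
    dsimp only
    rw [integral_eq_apply_default, integral_eq_apply_default, integral_eq_apply_default,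
      lgConfig_punit_eq (torusLift (2 * S + 1) (GaugeConfig.timeReflect default)) (torusLift (2 * S + 1) default),
      lgConfig_punit_eq (configShift _ (torusLift (2 * S + 1) default)) (torusLift (2 * S + 1) default)]
    have : Y (torusLift (2 * S + 1) default) * Y (torusLift (2 * S + 1) default) -
        Y (torusLift (2 * S + 1) default) ^ 2 = 0 := by ring
    rw [this]; simp
  · intro β _
    refine ⟨0, fun S _ n _ _ => ?_⟩
    rw [rpSquare_punit, rpSquare_punit]; simp

/-- The BODY of `LatticeGapInput` holds at `PUnit` (the stub itself is vacuous there, since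
`IsCompactSimpleLieGroup PUnit` fails — `punit_connected_not_simple`). -/
theorem latticeGapInput_body_punit :
    ∃ (r : LatticeRep PUnit) (β₁ C₁ c₂ : ℝ) (m : ℝ → ℝ), GapData PUnit r β₁ C₁ c₂ m :=
  ⟨punitRep, 0, 1, 1, _, gapData_punit punitRep 0 1 1⟩

/-- The body of **`CornerFreeInfluence`** holds at `G = PUnit` (with `C = 0`), whatever the data. -/
theorem cornerFreeInfluence_body_punit (m : ℝ → ℝ) (c₀ : ℝ) :
    ∃ (C β₀ : ℝ), ∀ β : ℝ, β₀ ≤ β → ∃ S₀ : ℕ, ∀ S : ℕ, S₀ ≤ S →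
      ∀ R : ℕ, 1 ≤ R → (R : ℝ) ≤ c₀ / m β → ∀ i j : Fin 4, i ≠ j →
        influence r β S R i j 2 ≤ C * Real.sqrt (rpSquare r β S R) :=
  ⟨0, 0, fun β _ => ⟨0, fun S _ R _ _ i j _ => by rw [influence_punit, rpSquare_punit]; simp⟩⟩

/-- The body of **`InfluenceReverseHolder`** holds at `G = PUnit` (with `C = 0`, `γ = 0`). -/
theorem influenceReverseHolder_body_punit (m : ℝ → ℝ) (c₀ : ℝ) :
    ∃ (C β₀ : ℝ) (γ : ℕ), ∀ β : ℝ, β₀ ≤ β → ∀ n : ℕ, 2 ≤ n →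
      ∃ S₀ : ℕ, ∀ S : ℕ, S₀ ≤ S → ∀ R : ℕ, 1 ≤ R → (R : ℝ) ≤ c₀ / m β → ∀ i j : Fin 4, i ≠ j →
        influence r β S R i j n ≤ C * (n : ℝ) ^ γ * influence r β S R i j 2 :=
  ⟨0, 0, 0, fun β _ n _ => ⟨0, fun S _ R _ _ i j _ => by rw [influence_punit, influence_punit]; simp⟩⟩

/-- The body of **`NonGaussianFloor`** holds at `G = PUnit` (zero test functions: the floor is
RELATIVE to `rpSquare`, which vanishes). -/
theorem nonGaussianFloor_body_punit (m : ℝ → ℝ) :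
    ∃ (s₁ σ c₁ β₀ : ℝ) (φ₁ φ₂ φ₃ : 𝓢(E4, ℝ)), 0 < s₁ ∧ (σ = 1 ∨ σ = -1) ∧ 0 < c₁ ∧
      tsupport φ₁ ⊆ Metric.ball 0 s₁ ∧ tsupport φ₂ ⊆ Metric.ball 0 s₁ ∧
      tsupport φ₃ ⊆ Metric.ball 0 s₁ ∧
      Disjoint (tsupport φ₁) (tsupport φ₂) ∧ Disjoint (tsupport φ₁) (tsupport φ₃) ∧
      Disjoint (tsupport φ₂) (tsupport φ₃) ∧
      ∀ β : ℝ, β₀ ≤ β → ∃ S₀ : ℕ, ∀ S : ℕ, S₀ ≤ S →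
        c₁ * Real.sqrt (rpSquare r β S ⌊s₁ / m β⌋₊) ^ 3 ≤
          σ * smearedThreePoint r β S (m β) φ₁ φ₂ φ₃ := by
  have h0 : tsupport ((0 : 𝓢(E4, ℝ)) : E4 → ℝ) = ∅ := by
    rw [tsupport_eq_empty_iff]; rfl
  refine ⟨1, 1, 1, 0, 0, 0, 0, one_pos, Or.inl rfl, one_pos, ?_, ?_, ?_, ?_, ?_, ?_, ?_⟩
  iterate 3 (rw [h0]; exact Set.empty_subset _)
  iterate 3 (rw [h0]; exact Set.empty_disjoint _  |>.mono_right le_rfl)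
  intro β _
  refine ⟨0, fun S _ => ?_⟩
  rw [rpSquare_punit, smearedThreePoint_zero]; simp

/-- Clauses (a) and (b) of **`WindowRegularity`** hold at `G = PUnit`. -/
theorem windowRegularity_ab_body_punit (β : ℝ) (S : ℕ) (C c : ℝ) (p : ℕ) :
    (∀ R R' : ℕ, rpSquare r β S R ≤ C * ((R' : ℝ) / R) ^ p * rpSquare r β S R') ∧
    (∀ (R : ℕ) (x y : Zd4), c * rpSquare r β S R ≤ reflPair r β S x y) := by
  refine ⟨fun R R' => ?_, fun R x y => ?_⟩
  · rw [rpSquare_punit, rpSquare_punit]; simp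
  · rw [rpSquare_punit, reflPair_punit]; simp

/-- Clause (c) of **`WindowRegularity`** FAILS at `G = PUnit` for every positive rate. -/
theorem windowRegularity_c_false_punit (m : ℝ → ℝ) {β : ℝ} (hm : 0 < m β) (S : ℕ) (q : ℕ) :
    ¬ m β ^ q ≤ rpSquare r β S 1 := by
  rw [rpSquare_punit]; exact not_le.mpr (pow_pos hm q)

/-- `WindowRegularity` with the hypothesis `IsCompactSimpleLieGroup G →` deleted (otherwise
verbatim). -/
def WindowRegularityWithoutSimple : Prop :=
  ∀ (G : Type) [Group G] [TopologicalSpace G] [IsTopologicalGroup G] [CompactSpace G]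
    [MeasurableSpace G] [BorelSpace G],
    ∀ (r : LatticeRep G) (β₁ C₁ c₂ : ℝ) (m : ℝ → ℝ), GapData G r β₁ C₁ c₂ m →
      ∀ c₀ : ℝ, 0 < c₀ → ∃ (C c θ β₀ : ℝ) (p q : ℕ), 0 < c ∧ 0 < θ ∧
        ∀ β : ℝ, β₀ ≤ β → ∃ S₀ : ℕ, ∀ S : ℕ, S₀ ≤ S →
          (∀ R R' : ℕ, 1 ≤ R → R ≤ R' → (R' : ℝ) ≤ c₀ / m β →
              rpSquare r β S R ≤ C * ((R' : ℝ) / R) ^ p * rpSquare r β S R') ∧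
          (∀ (R : ℕ) (x y : Zd4), 1 ≤ R → (R : ℝ) ≤ c₀ / m β →
              (R : ℝ) ≤ x 0 → (x 0 : ℝ) ≤ (1 + θ) * R → (R : ℝ) ≤ y 0 → (y 0 : ℝ) ≤ (1 + θ) * R →
              (∀ i : Fin 4, i ≠ 0 → (|x i - y i| : ℝ) ≤ θ * R) →
                c * rpSquare r β S R ≤ reflPair r β S x y) ∧
          m β ^ q ≤ rpSquare r β S 1

/-- With the simplicity hypothesis restored this IS the line's `WindowRegularity` (definitional
check that nothing else was changed). -/
theorem windowRegularity_iff_without_add_simple :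
    WindowRegularity ↔
      ∀ (G : Type) [Group G] [TopologicalSpace G] [IsTopologicalGroup G] [CompactSpace G]
        [MeasurableSpace G] [BorelSpace G], IsCompactSimpleLieGroup G →
        ∀ (r : LatticeRep G) (β₁ C₁ c₂ : ℝ) (m : ℝ → ℝ), GapData G r β₁ C₁ c₂ m →
          ∀ c₀ : ℝ, 0 < c₀ → ∃ (C c θ β₀ : ℝ) (p q : ℕ), 0 < c ∧ 0 < θ ∧
            ∀ β : ℝ, β₀ ≤ β → ∃ S₀ : ℕ, ∀ S : ℕ, S₀ ≤ S →
              (∀ R R' : ℕ, 1 ≤ R → R ≤ R' → (R' : ℝ) ≤ c₀ / m β →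
                  rpSquare r β S R ≤ C * ((R' : ℝ) / R) ^ p * rpSquare r β S R') ∧
              (∀ (R : ℕ) (x y : Zd4), 1 ≤ R → (R : ℝ) ≤ c₀ / m β →
                  (R : ℝ) ≤ x 0 → (x 0 : ℝ) ≤ (1 + θ) * R → (R : ℝ) ≤ y 0 →
                  (y 0 : ℝ) ≤ (1 + θ) * R → (∀ i : Fin 4, i ≠ 0 → (|x i - y i| : ℝ) ≤ θ * R) →
                    c * rpSquare r β S R ≤ reflPair r β S x y) ∧
              m β ^ q ≤ rpSquare r β S 1 :=
  Iff.rfl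

/-- **`IsCompactSimpleLieGroup` is load-bearing in `stub_windowRegularity`** (through clause (c)
only): deleting it makes the statement false, witness `G = PUnit`, `r = punitRep`,
`m(β) = e^{-β}` (admissible gap data by `gapData_punit`), where `rpSquare ≡ 0 < m(β)^q`.
Any proof of W2(c) must use that `G ≠ 1` (in the tree: faithfulness of `r` + non-abelianness,
cf. `Disproof.lean` §5b `variance_pos`). -/
theorem not_windowRegularityWithoutSimple : ¬ WindowRegularityWithoutSimple := by
  intro h
  obtain ⟨C, c, θ, β₀, p, q, -, -, h'⟩ :=
    h PUnit punitRep 0 1 1 (fun β => Real.exp (-β)) (gapData_punit punitRep 0 1 1) 1 one_pos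
  obtain ⟨S₀, hS⟩ := h' β₀ le_rfl
  exact windowRegularity_c_false_punit punitRep (fun β => Real.exp (-β)) (Real.exp_pos _) S₀ q
    (hS S₀ le_rfl).2.2

end PUnitModel

/-! ## drefute §2. Mutation of (T): the orientation guard `(o k).1 ≠ (o k).2` is not load-bearing

A "plaquette" of orientation `(i, i)` has trivial holonomy, so its observable is the constant
`Re tr ρ(1)` and its centred version vanishes identically; a product containing such a factor is
`0`, and `TelescopingBound`'s conclusion then holds for free (the right-hand side is a product of
non-negative reals).  So the hypothesis `∀ k, (o k).1 ≠ (o k).2` of (T) can be dropped by a case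
split — information for the prover of `stub_telescoping`, not a defect. -/

section DiagonalOrientation

variable {G : Type} [Group G] [TopologicalSpace G] [IsTopologicalGroup G] [CompactSpace G]
  [MeasurableSpace G] [BorelSpace G]

omit [TopologicalSpace G] [IsTopologicalGroup G] [CompactSpace G] [MeasurableSpace G] [BorelSpace G] in
/-- The holonomy of the degenerate plaquette `(x, i, i)` is `1`. -/
theorem plaquetteHolonomyZd_diag (U : LGConfig 4 G) (x : Zd4) (i : Fin 4) :
    plaquetteHolonomyZd U x i i = 1 := by
  simp [plaquetteHolonomyZd]

omit [IsTopologicalGroup G] [CompactSpace G] [MeasurableSpace G] [BorelSpace G] in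
/-- The torus plaquette observable of a degenerate orientation is the constant `Re tr ρ(1)`. -/
theorem torusPlaquette_diag (r : LatticeRep G) (L : ℕ) (i : Fin 4) (x : Zd4) (U : GaugeConfig 4 L G) :
    torusPlaquette r L i i x U = (r.ρ 1).trace.re := by
  simp [torusPlaquette, plaquetteObs, plaquetteHolonomyZd_diag]

/-- The influence profile is non-negative (verbatim from the skeleton). -/
theorem influence_nonneg (r : LatticeRep G) (β : ℝ) (S R : ℕ) (i j : Fin 4) (p : ℝ≥0∞) :
    0 ≤ influence r β S R i j p :=
  ENNReal.toReal_nonneg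

/-- **(T) at a degenerate orientation holds trivially**: if some `o k₀` is diagonal, the centred
product has a zero factor, the torus `n`-point function vanishes, and the telescoping bound holds
with no separation / fit hypothesis at all. -/
theorem telescopingBound_of_diag (r : LatticeRep G) (β : ℝ) (S R n : ℕ)
    (o : Fin n → Fin 4 × Fin 4) (x : Fin n → Zd4) (k₀ : Fin n) (hk : (o k₀).1 = (o k₀).2) :
    let μ := wilsonMeasure (d := 4) (L := 2 * S + 1) r.ρ β
    |∫ U, ∏ k, (torusPlaquette r (2 * S + 1) (o k).1 (o k).2 (x k) U -
        ∫ V, torusPlaquette r (2 * S + 1) (o k).1 (o k).2 (x k) V ∂μ) ∂μ|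
      ≤ ∏ k, influence r β S R (o k).1 (o k).2 n := by
  haveI := isProbabilityMeasure_wilsonMeasure (d := 4) (L := 2 * S + 1) r.ρ r.continuous β
  intro μ
  have hzero : ∀ U : GaugeConfig 4 (2 * S + 1) G,
      ∏ k, (torusPlaquette r (2 * S + 1) (o k).1 (o k).2 (x k) U -
        ∫ V, torusPlaquette r (2 * S + 1) (o k).1 (o k).2 (x k) V ∂μ) = 0 := by
    intro U
    refine Finset.prod_eq_zero (Finset.mem_univ k₀) ?_
    rw [hk, torusPlaquette_diag]
    simp only [torusPlaquette_diag, integral_const, smul_eq_mul]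
    simp
  simp only [hzero, integral_zero, abs_zero]
  exact Finset.prod_nonneg fun k _ => influence_nonneg r β S R (o k).1 (o k).2 n

end DiagonalOrientation

end Summit.QuantumFields.YangMills.Cruxes.HypercubicLimit.DRefute

end
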